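import Mathlib
import Literature.Analysis.FluidPDE.LagrangianTimeDerivativeTools
import Literature.Analysis.FluidPDE.LocalHelmholtzSupBound
import Literature.Analysis.PDE.DivFormStrongMaximumPrincipleClassical
import Summits.NavierStokesRegularity.NavierStokesRegularity.Theorems.ThreadingFluxHorizonTowerDefs
import Summits.NavierStokesRegularity.NavierStokesRegularity.Theorems.ThreadingFluxHorizonTowerFirstLemmas
import Summits.NavierStokesRegularity.NavierStokesRegularity.Theorems.ThreadingFluxHorizonTowerL2ClosedForm
import HarnessLib

/-!
# Crux `PoloidalLiouville` (stmt-NavierStokesRegularity-1222, W1), crux idea «horizon-threading-tower» (ns-idea-15):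
# SPHERE RIGIDITY — a tangential, degree-0 homogeneous, divergence-free, radially irrotational field on `ℝ³ ∖ {0}` vanishes

Support file (`--supports stmt-NavierStokesRegularity-1222`, helper), first of two toward the Defs statement
`HorizonTower.OrderOneSphereEuler` (the order-ONE horizon law = steady 2D Euler on `S²`).  Experiment cell
`ns-wall-extremal`, width hand ns-wall-eng-4 g3.  0 kit.

THE LEMMA (`HorizonTower.eq_zero_of_tangential_zeroHomogeneous`).  Let `V : ℝ³ → ℝ³` be `C²` off the origin, degree-0
homogeneous (`V(c y) = V(y)`, `c > 0`), tangent to the spheres (`⟪V x, x⟫ = 0`), divergence free off `0` and radially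
irrotational off `0` (`⟪curl V x, x⟫ = 0`).  Then `V ≡ 0` on `ℝ³ ∖ {0}`.  This is «`b₁(S²) = 0`» (a tangent vector field on
the sphere that is both divergence- and curl-free vanishes) in vector-calculus clothing, proved WITHOUT Hodge theory:

1. Euler `DV(x)[x] = 0` and the differentiated tangency `⟪DV(x)h, x⟫ = −⟪V x, h⟫` give `x × curl V = −V`
   (`⟪a × b, curl ψ⟫ = ⟪b, Dψ a⟫ − ⟪a, Dψ b⟫`, Literature `inner_cross_curl`), whence, with `⟪curl V, x⟫ = 0`,
   `curl V = (x × V)/‖x‖²` (`curl_eq_smul_cross`);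
2. hence `curl curl V = 0` off `0` (`curl_curl_eq_zero`: Leibniz rule, ARM A's `PoloidalField.curl_cross_self`, BAC−CAB);
3. hence `ΔV = ∇ div V − curl curl V = 0` off `0` (Literature `curl_curl_eq_sum_fderiv_divergence_sub_laplacian`, localised
   with a `ContDiffBump` cut-off) — `laplacian_eq_zero`;
4. each coordinate `Vᵢ` is then harmonic on the connected open set `ℝ³ ∖ {0}` and, being degree-0 homogeneous, attains its
   maximum over the unit sphere, an interior maximum: it is constant (Literature `divForm_strongMaximumPrinciple_of_contDiff`
   with `aᵢⱼ = δᵢⱼ`); a constant tangential field is `0`.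

HONEST FRAME: kinematics / elliptic rigidity about hypothetical scale-free profiles; nothing here bears on `PoloidalLiouville`
(1222) or NS regularity, both OPEN.

## References
* planner ns-idea-15, `Cruxes/PoloidalLiouville/HorizonTowerSketch.lean` (`OrderOneSphereEuler`).
* D. Gilbarg, N. S. Trudinger, *Elliptic PDE of Second Order*, Thm 3.5 (strong maximum principle). [GilbargTrudinger2001]
* A. J. Majda, A. L. Bertozzi, *Vorticity and Incompressible Flow* (CUP 2002), §1.1, §2.4.1. [MajdaBertozziCUP2002]
-/

-- the summit and its single problem share the name (D-0017 nested layout)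
set_option linter.dupNamespace false

noncomputable section

namespace Summit.NavierStokesRegularity.NavierStokesRegularity.Theorems.PoloidalLiouville.HorizonTower

open Set Function Filter Topology Metric
open scoped Topology RealInnerProductSpace Laplacian ContDiff
open Literature.Analysis.FluidPDE

namespace SphereRigidity

variable {V : E3 → E3}

/-! ### Step 1: `curl V = (x × V)/‖x‖²` -/

/-- Euler's identity for a degree-0 homogeneous field: `DV(x)[x] = 0`. -/
theorem fderiv_apply_self_eq_zero (hhom : ∀ c : ℝ, 0 < c → ∀ y : E3, V (c • y) = V y) {x : E3}
    (hVx : DifferentiableAt ℝ V x) : fderiv ℝ V x x = 0 := by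
  have hev : ∀ᶠ c in 𝓝 (1 : ℝ), V (c • x) = (fun _ : ℝ => (1 : ℝ)) c • V x := by
    filter_upwards [Ioi_mem_nhds (zero_lt_one' ℝ)] with c hc
    rw [hhom c hc x, one_smul]
  have h := PoloidalField.fderiv_apply_self_of_homogeneous (a := fun _ : ℝ => (1 : ℝ)) (a' := 0) hVx
    (hasDerivAt_const (1 : ℝ) (1 : ℝ)) hev
  rw [h, zero_smul]

/-- **`curl V = (x × V)/‖x‖²`** for a tangential degree-0 homogeneous field with `⟪curl V x, x⟫ = 0`, at a point `x ≠ 0`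
of differentiability. -/
theorem curl_eq_smul_cross (hhom : ∀ c : ℝ, 0 < c → ∀ y : E3, V (c • y) = V y)
    (htan : ∀ z : E3, inner ℝ (V z) z = 0) {x : E3} (hx : x ≠ 0) (hVx : DifferentiableAt ℝ V x)
    (hrot : inner ℝ (curl V x) x = 0) :
    curl V x = ((‖x‖ ^ 2) ^ (-1 : ℝ)) • cross x (V x) := by
  have htan' : ∀ z : E3, inner ℝ (V z) (z - 0) = 0 := fun z => by rw [sub_zero]; exact htan z
  -- `(curl V x) × x = V x`
  have hcx : cross (curl V x) x = V x := by
    refine ext_inner_left ℝ fun w => ?_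
    have h1 : inner ℝ (cross x w) (curl V x) = inner ℝ (V x) w := by
      rw [inner_cross_curl, fderiv_apply_self_eq_zero hhom hVx, inner_zero_right, zero_sub,
        real_inner_comm, ← neg_neg (inner ℝ (V x) w)]
      congr 1
      have := inner_fderiv_apply_of_tangent (x₀ := 0) hVx htan' w
      rw [sub_zero] at this
      exact this
    calc inner ℝ w (cross (curl V x) x) = inner ℝ (curl V x) (cross x w) := OrderTwo.inner_cross_cyclic _ _ _
      _ = inner ℝ (cross x w) (curl V x) := real_inner_comm _ _
      _ = inner ℝ (V x) w := h1
      _ = inner ℝ w (V x) := real_inner_comm _ _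
  -- `x × (curl V x × x) = ‖x‖² curl V x`
  have hq : (0 : ℝ) < ‖x‖ ^ 2 := by positivity
  have hxx : cross x (V x) = (‖x‖ ^ 2) • curl V x := by
    rw [← hcx, Tao2016.cross_cross_eq_smul_sub, real_inner_self_eq_norm_sq, real_inner_comm, hrot, zero_smul,
      sub_zero]
  rw [hxx, smul_smul, Real.rpow_neg_one, inv_mul_cancel₀ hq.ne', one_smul]

/-! ### Step 2: `curl curl V = 0` off the origin -/

/-- **`curl (curl V) = 0` off the origin** for a field `C²` off `0`, tangential, degree-0 homogeneous, divergence free and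
radially irrotational off `0`. -/
theorem curl_curl_eq_zero (hV : ContDiffOn ℝ 2 V {0}ᶜ) (hhom : ∀ c : ℝ, 0 < c → ∀ y : E3, V (c • y) = V y)
    (htan : ∀ z : E3, inner ℝ (V z) z = 0) (hdiv : ∀ x : E3, x ≠ 0 → VectorCalculus.divergence V x = 0)
    (hrot : ∀ x : E3, x ≠ 0 → inner ℝ (curl V x) x = 0) {x : E3} (hx : x ≠ 0) :
    curl (curl V) x = 0 := by
  have hopen : IsOpen ({0}ᶜ : Set E3) := isOpen_compl_singleton
  have hVd : ∀ z : E3, z ≠ 0 → DifferentiableAt ℝ V z := fun z hz =>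
    ((hV z hz).contDiffAt (hopen.mem_nhds hz)).differentiableAt (by norm_num)
  -- `curl V = ‖·‖⁻² (· × V)` near `x`
  have hev : curl V =ᶠ[𝓝 x] fun z => ((‖z‖ ^ 2) ^ (-1 : ℝ)) • cross z (V z) := by
    filter_upwards [hopen.mem_nhds hx] with z hz
    exact curl_eq_smul_cross hhom htan hz (hVd z hz) (hrot z hz)
  rw [curl_eq_curlCLM, hev.fderiv_eq, ← curl_eq_curlCLM]
  -- Leibniz rule
  have hφ : DifferentiableAt ℝ (fun z : E3 => (‖z‖ ^ 2) ^ (-1 : ℝ)) x := OrderTwo.differentiableAt_rpow_normSq hx _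
  have hneg : (fun z : E3 => cross z (V z)) = fun z => -cross (V z) z := by
    funext z
    simp only [cross, ← cross_anticomm (WithLp.ofLp (V z)) (WithLp.ofLp z), WithLp.toLp_neg]
  have hc : DifferentiableAt ℝ (fun z : E3 => cross z (V z)) x := by
    rw [hneg]; exact ((hasFDerivAt_cross (hVd x hx).hasFDerivAt (hasFDerivAt_id x)).differentiableAt).neg
  rw [curl_smul hφ hc, fderiv_eq_innerSL_gradient, curlCLM_smulRight_innerSL, OrderTwo.gradient_rpow_normSq hx,
    hneg, curl_neg, PoloidalField.curl_cross_self (hVd x hx), fderiv_apply_self_eq_zero hhom (hVd x hx), hdiv x hx,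
    zero_smul, sub_zero, zero_add, smul_neg, ← neg_smul]
  -- the algebra: `−2q⁻¹ V + (2·(−1)·q⁻²) x × (x × V) = 0`, `q = ‖x‖²`
  have hq : (0 : ℝ) < ‖x‖ ^ 2 := by positivity
  have hsl : ∀ (κ : ℝ) (a b : E3), cross (κ • a) b = κ • cross a b := fun κ a b => by
    rw [← crossCLM_apply, ← crossCLM_apply, map_smul]; rfl
  have hxVx : cross x (cross x (V x)) = -((‖x‖ ^ 2) • V x) := by
    rw [Tao2016.cross_cross_eq_smul_sub, real_inner_self_eq_norm_sq, real_inner_comm, htan x, zero_smul, zero_sub]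
  rw [hsl, hxVx]
  have hcoef : -(2 * (‖x‖ ^ 2) ^ (-1 : ℝ)) - (2 * (-1 * (‖x‖ ^ 2) ^ ((-1 : ℝ) - 1))) * ‖x‖ ^ 2 = 0 := by
    rw [Real.rpow_sub_one hq.ne']
    field_simp
    ring
  have key : ∀ (a κ q : ℝ) (v : E3), -a • (2 : ℝ) • v + κ • -(q • v) = (-(2 * a) - κ * q) • v := by
    intro a κ q v; module
  rw [key, hcoef, zero_smul]

/-! ### Step 3: `ΔV = 0` off the origin -/

/-- **`ΔV = 0` off the origin** (from `curl curl V = 0`, `div V = 0` and `curl curl = ∇div − Δ`, the latter applied to a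
cut-off copy of `V` that is `C²` on all of `ℝ³`). -/
theorem laplacian_eq_zero (hV : ContDiffOn ℝ 2 V {0}ᶜ) (hhom : ∀ c : ℝ, 0 < c → ∀ y : E3, V (c • y) = V y)
    (htan : ∀ z : E3, inner ℝ (V z) z = 0) (hdiv : ∀ x : E3, x ≠ 0 → VectorCalculus.divergence V x = 0)
    (hrot : ∀ x : E3, x ≠ 0 → inner ℝ (curl V x) x = 0) {x : E3} (hx : x ≠ 0) :
    (Δ V) x = 0 := by
  have hopen : IsOpen ({0}ᶜ : Set E3) := isOpen_compl_singleton
  have hxpos : 0 < ‖x‖ := norm_pos_iff.mpr hx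
  -- a cut-off equal to `1` near `x` and to `0` near the origin
  let χ : ContDiffBump x := ⟨‖x‖ / 4, ‖x‖ / 2, by positivity, by linarith⟩
  set W : E3 → E3 := fun z => χ z • V z with hW
  have hB0 : ∀ y ∈ ball x (‖x‖ / 4), y ≠ 0 := by
    intro y hy h0
    rw [h0, mem_ball, dist_comm, dist_zero_right] at hy
    linarith
  -- `W = V` near every point of the small ball, hence `curl W = curl V` and `div W = div V` there
  have hWV : ∀ y ∈ ball x (‖x‖ / 4), W =ᶠ[𝓝 y] V := by
    intro y hy
    filter_upwards [isOpen_ball.mem_nhds hy] with z hz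
    show χ z • V z = V z
    rw [χ.one_of_mem_closedBall (ball_subset_closedBall hz), one_smul]
  have hcurl : curl W =ᶠ[𝓝 x] curl V := by
    filter_upwards [isOpen_ball.mem_nhds (mem_ball_self (by positivity : (0:ℝ) < ‖x‖ / 4))] with y hy
    rw [curl_eq_curlCLM, curl_eq_curlCLM, (hWV y hy).fderiv_eq]
  have hdivW : VectorCalculus.divergence W =ᶠ[𝓝 x] fun _ => (0 : ℝ) := by
    filter_upwards [isOpen_ball.mem_nhds (mem_ball_self (by positivity : (0:ℝ) < ‖x‖ / 4))] with y hy
    unfold VectorCalculus.divergence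
    rw [(hWV y hy).fderiv_eq]
    exact hdiv y (hB0 y hy)
  -- `W` is `C²` on all of `ℝ³`
  have hWc : ContDiff ℝ 2 W := by
    rw [contDiff_iff_contDiffAt]
    intro z
    by_cases hz : z = 0
    · have hzero : W =ᶠ[𝓝 z] fun _ => (0 : E3) := by
        subst hz
        have h0 : ‖x‖ / 2 < dist (0 : E3) x := by rw [dist_comm, dist_zero_right]; linarith
        have hcont : Continuous fun y : E3 => dist y x := continuous_id.dist continuous_const
        filter_upwards [hcont.continuousAt.eventually (Ioi_mem_nhds h0)] with y hy
        show χ y • V y = 0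
        rw [χ.zero_of_le_dist (le_of_lt hy), zero_smul]
      exact contDiffAt_const.congr_of_eventuallyEq hzero
    · exact (χ.contDiff (n := 2)).contDiffAt.smul ((hV z hz).contDiffAt (hopen.mem_nhds hz))
  -- `curl curl W (x) = 0`, `∇ div W (x) = 0`, hence `ΔW(x) = 0`
  have h1 : curl (curl W) x = 0 := by
    rw [curl_eq_curlCLM, hcurl.fderiv_eq, ← curl_eq_curlCLM]
    exact curl_curl_eq_zero hV hhom htan hdiv hrot hx
  have h2 : fderiv ℝ (VectorCalculus.divergence W) x = 0 := by
    rw [hdivW.fderiv_eq, fderiv_fun_const, Pi.zero_apply]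
  have h3 := curl_curl_eq_sum_fderiv_divergence_sub_laplacian hWc x
  rw [h1, h2] at h3
  simp only [zero_apply, zero_smul, Finset.sum_const_zero, zero_sub, zero_eq_neg] at h3
  -- `ΔV(x) = ΔW(x)`
  have h4 := (InnerProductSpace.laplacian_congr_nhds
    (hWV x (mem_ball_self (by positivity : (0:ℝ) < ‖x‖ / 4)))).eq_of_nhds
  rw [← h4, h3]

/-! ### Step 4: harmonic, degree-0 homogeneous coordinates are constant (strong maximum principle) -/

/-- Local form of `Δu(x) = Σᵢ ∂ᵢ∂ᵢu(x)` in the standard frame, for `u` of class `C²` at `x`. -/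
theorem laplacian_eq_sum_single {u : E3 → ℝ} {x : E3} (hu : ContDiffAt ℝ 2 u x) :
    (Δ u) x = ∑ i, fderiv ℝ (fun y => fderiv ℝ u y (EuclideanSpace.single i (1 : ℝ))) x
      (EuclideanSpace.single i (1 : ℝ)) := by
  have hd : DifferentiableAt ℝ (fderiv ℝ u) x :=
    (hu.fderiv_right (m := 1) (by norm_num)).differentiableAt (by simp)
  rw [InnerProductSpace.laplacian_eq_iteratedFDeriv_orthonormalBasis u (EuclideanSpace.basisFun (Fin 3) ℝ)]
  refine Finset.sum_congr rfl fun i _ => ?_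
  rw [iteratedFDeriv_two_apply, fderiv_clm_apply hd (differentiableAt_const _)]
  simp

/-- **Sphere rigidity.**  A field `V : ℝ³ → ℝ³` of class `C²` off the origin, degree-0 homogeneous, tangent to the spheres,
divergence free off `0` and radially irrotational off `0` (`⟪curl V x, x⟫ = 0`) vanishes off the origin. -/
theorem eq_zero (hV : ContDiffOn ℝ 2 V {0}ᶜ) (hhom : ∀ c : ℝ, 0 < c → ∀ y : E3, V (c • y) = V y)
    (htan : ∀ z : E3, inner ℝ (V z) z = 0) (hdiv : ∀ x : E3, x ≠ 0 → VectorCalculus.divergence V x = 0)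
    (hrot : ∀ x : E3, x ≠ 0 → inner ℝ (curl V x) x = 0) {x : E3} (hx : x ≠ 0) :
    V x = 0 := by
  have hopen : IsOpen ({0}ᶜ : Set E3) := isOpen_compl_singleton
  have hrank : 1 < Module.rank ℝ E3 := by
    rw [← Module.finrank_eq_rank]
    norm_cast
    simp
  have hconn : IsPreconnected ({0}ᶜ : Set E3) :=
    (isConnected_compl_singleton_of_one_lt_rank hrank 0).isPreconnected
  -- every coordinate is constant on `ℝ³ ∖ {0}`
  have hconst : ∀ z : E3, z ≠ 0 → V z = V x := by
    intro z hz
    ext i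
    -- the coordinate `u = Vᵢ`
    set u : E3 → ℝ := fun y => V y i with hu_def
    have hueq : u = (EuclideanSpace.proj i : E3 →L[ℝ] ℝ) ∘ V := by funext y; rfl
    have hu : ContDiffOn ℝ 2 u {0}ᶜ := by
      rw [hueq]; exact (EuclideanSpace.proj i : E3 →L[ℝ] ℝ).contDiff.comp_contDiffOn hV
    -- `u` is harmonic off the origin
    have hΔu : ∀ y : E3, y ≠ 0 → (Δ u) y = 0 := by
      intro y hy
      have hVy : ContDiffAt ℝ 2 V y := (hV y hy).contDiffAt (hopen.mem_nhds hy)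
      rw [hueq, hVy.laplacian_CLM_comp_left, Function.comp_apply, laplacian_eq_zero hV hhom htan hdiv hrot hy,
        map_zero]
    -- a maximiser on the unit sphere is an interior maximiser on `ℝ³ ∖ {0}`
    obtain ⟨x₁, hx₁S, hmax₁⟩ : ∃ x₁ ∈ sphere (0 : E3) 1, IsMaxOn u (sphere (0 : E3) 1) x₁ := by
      refine (isCompact_sphere (0 : E3) 1).exists_isMaxOn ⟨‖x‖⁻¹ • x, ?_⟩ ?_
      · rw [mem_sphere_zero_iff_norm, norm_smul, norm_inv, norm_norm, inv_mul_cancel₀ (norm_ne_zero_iff.mpr hx)]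
      · refine (hu.continuousOn.mono ?_)
        intro y hy h0
        rw [mem_sphere_zero_iff_norm] at hy
        rw [h0, norm_zero] at hy
        exact zero_ne_one hy
    have hx₁ : x₁ ≠ 0 := by
      intro h0; rw [h0, mem_sphere_zero_iff_norm, norm_zero] at hx₁S; exact zero_ne_one hx₁S
    have hmax : ∀ y ∈ ({0}ᶜ : Set E3), u y ≤ u x₁ := by
      intro y hy
      have hy0 : y ≠ 0 := hy
      have hny : 0 < ‖y‖ := norm_pos_iff.mpr hy0
      have hmem : ‖y‖⁻¹ • y ∈ sphere (0 : E3) 1 := by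
        rw [mem_sphere_zero_iff_norm, norm_smul, norm_inv, norm_norm, inv_mul_cancel₀ hny.ne']
      have hval : u y = u (‖y‖⁻¹ • y) := by
        simp only [hu_def, hhom _ (inv_pos.mpr hny) y]
      rw [hval]
      exact hmax₁ hmem
    -- strong maximum principle for `Δ` on the connected open set `ℝ³ ∖ {0}`
    have hsmp := Literature.Analysis.PDE.divForm_strongMaximumPrinciple_of_contDiff hopen hconn
      (a := fun _ i j => if i = j then (1 : ℝ) else 0) (u := u) (μ := 1)
      (fun _ _ i j => by by_cases h : i = j <;> simp [h, eq_comm])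
      one_pos
      (fun _ _ ξ => by
        have hsum : ∑ i, ∑ j, (if i = j then (1 : ℝ) else 0) * ξ i * ξ j = ∑ i, ξ i * ξ i := by
          refine Finset.sum_congr rfl fun i _ => ?_
          simp only [ite_mul, one_mul, zero_mul, Finset.sum_ite_eq, Finset.mem_univ, if_true]
        have hnorm : ‖ξ‖ ^ 2 = ∑ i, ξ i * ξ i := by
          rw [EuclideanSpace.norm_sq_eq]
          exact Finset.sum_congr rfl fun i _ => by rw [Real.norm_eq_abs, sq_abs, sq]
        rw [one_mul, hsum, hnorm])
      (fun _ _ => contDiffOn_const) hu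
      (by
        intro y hy
        have hy0 : y ≠ 0 := hy
        have hinner : ∀ i', (fun w => ∑ j, (if i' = j then (1 : ℝ) else 0) * fderiv ℝ u w (EuclideanSpace.single j 1))
            = fun w => fderiv ℝ u w (EuclideanSpace.single i' 1) := by
          intro i'; funext w
          simp only [ite_mul, one_mul, zero_mul, Finset.sum_ite_eq, Finset.mem_univ, if_true]
        simp only [hinner]
        have huy : ContDiffAt ℝ 2 u y := (hu y hy0).contDiffAt (hopen.mem_nhds hy0)
        rw [← laplacian_eq_sum_single huy, hΔu y hy0])
      hx₁ hmax
    have h1 : u z = u x₁ := hsmp z hz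
    have h2 : u x = u x₁ := hsmp x hx
    show u z = u x
    rw [h1, h2]
  -- a constant tangential field vanishes
  by_contra hne
  have h := htan (V x)
  rw [hconst (V x) hne, inner_self_eq_zero] at h
  exact hne h

end SphereRigidity

end Summit.NavierStokesRegularity.NavierStokesRegularity.Theorems.PoloidalLiouville.HorizonTower

end
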